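import Summits.AnomalousDissipation.AnomalousDissipation.Theorems.TwoAndHalfDTwohalfdNegReductionOffZero
import Summits.AnomalousDissipation.AnomalousDissipation.Theorems.TwoAndHalfDTwohalfdNegPlanarNoAnomaly
import Summits.AnomalousDissipation.AnomalousDissipation.Theorems.TwoAndHalfDTwohalfdNegCertificate
import Summits.AnomalousDissipation.AnomalousDissipation.Theorems.TwoAndHalfDSourcedScalarUnique2D
import Summits.AnomalousDissipation.AnomalousDissipation.Theorems.TwoAndHalfDScalarLift2halfDR
import Summits.AnomalousDissipation.AnomalousDissipation.Theorems.TwohalfdNeg.Negative.ZeroMeanAndKillShape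
import Literature.Analysis.FluidPDE.LongTimeAverageNonneg

/-!
# The crux `TwoAndHalfD.TwohalfdNeg` (stmt-AnomalousDissipation-0211) IS the planar no-anomaly law:
# kernel-checked identification with `¬ ScalarAnomalySteadySourceFormal` (stmt-AnomalousDissipation-0448)

The two crux items of route `TwoAndHalfD` are EXACT complements of one two-dimensional statement.

* `twohalfdThesis_iff_scalarAnomalySteadySourceFormal` — `→` is **`X ⇒ #2` made a theorem** (the
  route's kill criterion, so far "on paper"): an `x₃`-invariant zeroth-law witness splits (reduction S1',
  `ReductionOffZero.stub_reductionOffZero`, valid for `t ≠ 0`, which the `limsup` means do not see)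
  into a bounded-energy planar Leray–Hopf family `v_j` forced by the planar part `g` of the force and
  bounded-variance weak sourced scalars `θ_j` (source `h` = third component); the planar dissipation
  tends to `0` (S2, Alexakis–Doering, `PlanarNoAnomaly.stub_planarNoAnomaly`), the three-dimensional
  dissipation sub-splits, so from some index on the scalar keeps `≥ ε/2` of the anomaly; shifting the
  index (`j ↦ j + J`, `ν_{j+J} → 0`) gives a witness of `ScalarAnomalySteadySourceFormal` by name;
  `←` is the route's glue chain #2 ⇒ X: the glue item `ScalarLiftGlueR` (stmt-AnomalousDissipation-14984,
  PROVED: `Theorems.scalarLiftGlueR_proof`) is carried as the explicit hypothesis `hG` of the `↔`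
  theorems below and fed here with the proved supports `sourcedScalarUnique2D_proof` (stmt-14323) and
  `scalarLift2halfDR_proof` (stmt-14983); instantiate `hG := Theorems.scalarLiftGlueR_proof` to read
  every statement unconditionally (the module `TwoAndHalfDScalarLiftGlueR` is deliberately not
  imported: at the time of writing the hub holds no object file for it, and the dependence on the
  glue chain is worth displaying anyway).
* `twohalfdNeg_iff_not_scalarAnomalySteadySourceFormal` — through the kill shape
  `Negative.twohalfdNeg_iff_not_twohalfdThesis`: **crux 0211 ≡ ¬ crux 0448**.
* `not_scalarAnomalySteadySourceFormal_iff_planar` and `twohalfdNeg_iff_planar` — the same statement in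
  `Tendsto` form, the honest "promotable residual" every lead of the line
  `log-kantorovich-enstrophy-transfer` asked for: for all smooth divergence-free mean-zero `g`, smooth
  mean-zero `h`, `ν_j → 0`, global Leray–Hopf `v_j` forced by `g`, `L²` scalar data and global weak
  sourced scalars `θ_j` over `v_j` with `ν`-uniformly bounded `limsup`-mean energy and variance, the
  `limsup`-mean scalar dissipation `⟨ν_j‖∇θ_j‖²⟩ → 0` (subsequence extraction, `longTimeAvgSup_nonneg`).
* `planar_of_subLogStrain` — the line's transfer certificate in purely planar clothes: the registered
  residual S6 (`stub_subLogStrain`: sub-logarithmic mean strain of bounded-energy steadily forced planar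
  Leray–Hopf families) implies the planar no-anomaly law, i.e. S6 REFUTES crux 0448
  (`Certificate.twohalfdNeg_of_subLogStrain` composed with the identification).

The file closes with the registered tools stub `stub_planarIdentification` (conjunction of the five).
No new analysis: bookkeeping over landed theorems.  Supports stmt-AnomalousDissipation-0211.
-/

namespace Summit.AnomalousDissipation.AnomalousDissipation.Theorems.TwohalfdNeg.PlanarIdentification

open MeasureTheory Filter Topology
open scoped ENNReal NNReal
open Literature.Analysis.FunctionSpaces Literature.Analysis.FluidPDE
open Summit.AnomalousDissipation.AnomalousDissipation.Theses.TwoAndHalfD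
open Summit.AnomalousDissipation.AnomalousDissipation.Theorems.TwohalfdNeg

set_option linter.dupNamespace false

/-- **The route target and the sibling crux are equivalent: `TwohalfdThesis ↔
ScalarAnomalySteadySourceFormal`.** `→` (**`X ⇒ #2`**, the route's kill criterion, so far on
paper): an `x₃`-invariant zeroth-law witness splits by the reduction S1'
(`ReductionOffZero.stub_reductionOffZero`; sections for `t ≠ 0`, invisible to the `limsup` means)
into a bounded-energy planar Leray–Hopf family forced by the planar part `g` of the force and
bounded-variance weak sourced scalars (source `h` = third component); the planar dissipation tends
to `0` (S2, Alexakis–Doering, `PlanarNoAnomaly.stub_planarNoAnomaly`) and the dissipation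
sub-splits, so past the rank `J` where the planar dissipation is `< ε/2` the scalar keeps `≥ ε/2`;
the index shift `j ↦ j + J` (`ν_{j+J} → 0`) gives a witness of crux #2 by name.  `←`: the glue
item `ScalarLiftGlueR` (hypothesis `hG`; proved in tree as `Theorems.scalarLiftGlueR_proof`) fed with
the proved supports `sourcedScalarUnique2D_proof` and `scalarLift2halfDR_proof`. [folklore] -/
theorem twohalfdThesis_iff_scalarAnomalySteadySourceFormal (hG : ScalarLiftGlueR) :
    TwohalfdThesis ↔ ScalarAnomalySteadySourceFormal := by
  constructor
  · rintro ⟨f, hfinv, hfs, hfd, hfz, ν, u₀, u, hν, hν0, hLH, huinv, hE, ε, hε, hεj⟩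
    obtain ⟨g, h, v₀, v, θ₀, θ, hgs, hgd, hgz, hhs, hhz, -, -, hvLH, hθ₀, hθw, hEv, hEθ, hsplit⟩ :=
      ReductionOffZero.stub_reductionOffZero f hfinv hfs hfd hfz ν u₀ u hν hLH huinv hE
    have hplanar : Tendsto (fun j => meanDissipation (ν j) (v j)) atTop (𝓝 0) :=
      PlanarNoAnomaly.stub_planarNoAnomaly g hgs hgd hgz ν v₀ v hν hν0 hvLH hEv
    obtain ⟨J, hJ⟩ := eventually_atTop.1 (hplanar.eventually (gt_mem_nhds (half_pos hε)))
    obtain ⟨Ev, hEv'⟩ := hEv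
    obtain ⟨Eθ, hEθ'⟩ := hEθ
    refine ⟨g, h, hgs, hgd, hgz, hhs, hhz, fun j => ν (j + J), fun j => v₀ (j + J),
      fun j => v (j + J), fun j => θ₀ (j + J), fun j => θ (j + J), fun j => hν (j + J),
      hν0.comp (tendsto_add_atTop_nat J), fun j => hvLH (j + J), fun j => hθ₀ (j + J),
      fun j => hθw (j + J), ⟨Ev, fun j => hEv' (j + J)⟩, ⟨Eθ, fun j => hEθ' (j + J)⟩, ε / 2,
      half_pos hε, fun j => ?_⟩
    have h1 := hεj (j + J)
    have h2 := hsplit (j + J)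
    have h3 := hJ (j + J) (Nat.le_add_left J j)
    linarith
  · exact fun hA =>
      hG hA
        Summit.AnomalousDissipation.AnomalousDissipation.Theorems.sourcedScalarUnique2D_proof
        Summit.AnomalousDissipation.AnomalousDissipation.Theorems.scalarLift2halfDR_proof

/-- **Crux 0211 ≡ ¬ crux 0448: `TwohalfdNeg ↔ ¬ ScalarAnomalySteadySourceFormal`.** The in-class
negation of the zeroth law is exactly the uniform planar statement "no steady-source scalar anomaly
at bounded energy and bounded variance over steadily forced 2-D Leray–Hopf flows at `Pr = 1`"
(kill shape `Negative.twohalfdNeg_iff_not_twohalfdThesis` + the equivalence above; `hG` = the proved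
glue item `ScalarLiftGlueR`, discharge with `Theorems.scalarLiftGlueR_proof`). [folklore] -/
theorem twohalfdNeg_iff_not_scalarAnomalySteadySourceFormal (hG : ScalarLiftGlueR) :
    TwohalfdNeg ↔ ¬ ScalarAnomalySteadySourceFormal := by
  rw [Negative.twohalfdNeg_iff_not_twohalfdThesis, twohalfdThesis_iff_scalarAnomalySteadySourceFormal hG]

/-- **The planar no-anomaly law in `Tendsto` form is the negation of crux 0448.** For every
admissible `(g, h)` and every candidate family (global Leray–Hopf `v_j` forced by `g`, `L²` scalar data,
global weak sourced scalars `θ_j`, `ν_j → 0`) with bounded `limsup`-mean energy and variance, the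
`limsup`-mean scalar dissipation tends to `0` — iff no witness of `ScalarAnomalySteadySourceFormal`
exists (`←`: evaluate; `→`: the dissipation means are `≥ 0`, `longTimeAvgSup_nonneg`, so failure of
`Tendsto … (𝓝 0)` gives `ε > 0` undershot only along a co-frequent set; extract a subsequence with
`Filter.extraction_of_frequently_atTop`, along which every hypothesis persists and `ν ∘ φ → 0`). [folklore] -/
theorem not_scalarAnomalySteadySourceFormal_iff_planar :
    ¬ ScalarAnomalySteadySourceFormal ↔
      ∀ (g : UnitAddTorus (Fin 2) → EuclideanSpace ℝ (Fin 2)) (h : UnitAddTorus (Fin 2) → ℝ),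
        Torus.IsSmooth g → Torus.IsDivFree g → Torus.HasZeroMean g →
        Torus.IsSmooth h → Torus.HasZeroMean h →
        ∀ (ν : ℕ → ℝ) (v₀ : ℕ → UnitAddTorus (Fin 2) → EuclideanSpace ℝ (Fin 2))
          (v : ℕ → ℝ → UnitAddTorus (Fin 2) → EuclideanSpace ℝ (Fin 2))
          (θ₀ : ℕ → UnitAddTorus (Fin 2) → ℝ) (θ : ℕ → ℝ → UnitAddTorus (Fin 2) → ℝ),
          (∀ j, 0 < ν j) → Tendsto ν atTop (𝓝 0) →
          (∀ j, Torus.IsGlobalLerayHopf (ν j) (fun _ => g) (v₀ j) (v j)) →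
          (∀ j, MemLp (θ₀ j) 2 volume) →
          (∀ j, Torus.IsWeakScalarTransportForced (ν j) (v j) (fun _ => h) (θ₀ j) (θ j)) →
          (∃ E : ℝ, ∀ j, meanEnergy (v j) ≤ E) →
          (∃ E : ℝ, ∀ j, longTimeAvgSup (fun t => Torus.scalarL2Sq (θ j t)) ≤ E) →
          Tendsto (fun j => longTimeAvgSup (fun t => ν j * (Torus.eScalarGradNormSq (θ j t)).toReal))
            atTop (𝓝 0) := by
  constructor
  · intro hN g h hgs hgd hgz hhs hhz ν v₀ v θ₀ θ hν hν0 hLH hθ₀ hθw hEv hEθ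
    by_contra hnt
    have hfreq : ∃ ε : ℝ, 0 < ε ∧ ∃ᶠ j in atTop,
        ε ≤ longTimeAvgSup (fun t => ν j * (Torus.eScalarGradNormSq (θ j t)).toReal) := by
      by_contra hall
      push Not at hall
      apply hnt
      rw [tendsto_order]
      refine ⟨fun b hb => Eventually.of_forall fun j => hb.trans_le ?_, fun b hb => hall b hb⟩
      exact longTimeAvgSup_nonneg fun t => mul_nonneg (hν j).le ENNReal.toReal_nonneg
    obtain ⟨ε, hε, hfr⟩ := hfreq
    obtain ⟨φ, hφ, hφε⟩ := extraction_of_frequently_atTop hfr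
    obtain ⟨Ev, hEv'⟩ := hEv
    obtain ⟨Eθ, hEθ'⟩ := hEθ
    exact hN ⟨g, h, hgs, hgd, hgz, hhs, hhz, ν ∘ φ, v₀ ∘ φ, v ∘ φ, θ₀ ∘ φ, θ ∘ φ,
      fun j => hν (φ j), hν0.comp hφ.tendsto_atTop, fun j => hLH (φ j), fun j => hθ₀ (φ j),
      fun j => hθw (φ j), ⟨Ev, fun j => hEv' (φ j)⟩, ⟨Eθ, fun j => hEθ' (φ j)⟩, ε, hε, hφε⟩
  · rintro hP ⟨g, h, hgs, hgd, hgz, hhs, hhz, ν, v₀, v, θ₀, θ, hν, hν0, hLH, hθ₀, hθw, hEv, hEθ, ε, hε, hεj⟩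
    have ht := hP g h hgs hgd hgz hhs hhz ν v₀ v θ₀ θ hν hν0 hLH hθ₀ hθw hEv hEθ
    obtain ⟨j, hj⟩ := (ht.eventually (gt_mem_nhds hε)).exists
    exact (not_lt.2 (hεj j)) hj

/-- **`TwohalfdNeg ↔` the planar no-anomaly law (Tendsto form).** The crux of route `TwoAndHalfD` /
route `Neg` #3 is, verbatim up to this kernel-checked equivalence, the two-dimensional statement: every
bounded-energy steadily forced planar Leray–Hopf family carries every steadily sourced, bounded-variance
passive scalar at `Pr = 1` with vanishing `limsup`-mean dissipation as `ν_j → 0`. This is the exact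
statement to promote; the line's S6 (`stub_subLogStrain`) and its Lagrangian form are sufficient
conditions for it (`hG` = the proved glue item `ScalarLiftGlueR`). [folklore] -/
theorem twohalfdNeg_iff_planar (hG : ScalarLiftGlueR) :
    TwohalfdNeg ↔
      ∀ (g : UnitAddTorus (Fin 2) → EuclideanSpace ℝ (Fin 2)) (h : UnitAddTorus (Fin 2) → ℝ),
        Torus.IsSmooth g → Torus.IsDivFree g → Torus.HasZeroMean g →
        Torus.IsSmooth h → Torus.HasZeroMean h →
        ∀ (ν : ℕ → ℝ) (v₀ : ℕ → UnitAddTorus (Fin 2) → EuclideanSpace ℝ (Fin 2))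
          (v : ℕ → ℝ → UnitAddTorus (Fin 2) → EuclideanSpace ℝ (Fin 2))
          (θ₀ : ℕ → UnitAddTorus (Fin 2) → ℝ) (θ : ℕ → ℝ → UnitAddTorus (Fin 2) → ℝ),
          (∀ j, 0 < ν j) → Tendsto ν atTop (𝓝 0) →
          (∀ j, Torus.IsGlobalLerayHopf (ν j) (fun _ => g) (v₀ j) (v j)) →
          (∀ j, MemLp (θ₀ j) 2 volume) →
          (∀ j, Torus.IsWeakScalarTransportForced (ν j) (v j) (fun _ => h) (θ₀ j) (θ j)) →
          (∃ E : ℝ, ∀ j, meanEnergy (v j) ≤ E) →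
          (∃ E : ℝ, ∀ j, longTimeAvgSup (fun t => Torus.scalarL2Sq (θ j t)) ≤ E) →
          Tendsto (fun j => longTimeAvgSup (fun t => ν j * (Torus.eScalarGradNormSq (θ j t)).toReal))
            atTop (𝓝 0) :=
  (twohalfdNeg_iff_not_scalarAnomalySteadySourceFormal hG).trans not_scalarAnomalySteadySourceFormal_iff_planar

/-- **S6 ⇒ the planar no-anomaly law (the transfer certificate, planar form): the registered residual
`stub_subLogStrain` of the line `log-kantorovich-enstrophy-transfer` REFUTES crux 0448.** If every
bounded-energy steadily forced planar Leray–Hopf family has sub-logarithmic `limsup`-mean strain,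
`⟨‖∇v_j‖₂⟩ / log(1/ν_j) → 0`, then every steadily sourced bounded-variance scalar over such a family has
`⟨ν_j‖∇θ_j‖²⟩ → 0` (`Certificate.twohalfdNeg_of_subLogStrain` + `twohalfdNeg_iff_planar`; `hG` = the
proved glue item `ScalarLiftGlueR`). [folklore] -/
theorem planar_of_subLogStrain (hG : ScalarLiftGlueR)
    (hS6 : ∀ g : UnitAddTorus (Fin 2) → EuclideanSpace ℝ (Fin 2),
      Torus.IsSmooth g → Torus.IsDivFree g → Torus.HasZeroMean g →
      ∀ (ν : ℕ → ℝ) (v₀ : ℕ → UnitAddTorus (Fin 2) → EuclideanSpace ℝ (Fin 2))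
        (v : ℕ → ℝ → UnitAddTorus (Fin 2) → EuclideanSpace ℝ (Fin 2)),
        (∀ j, 0 < ν j) → Tendsto ν atTop (𝓝 0) →
        (∀ j, Torus.IsGlobalLerayHopf (ν j) (fun _ => g) (v₀ j) (v j)) →
        (∃ E : ℝ, ∀ j, meanEnergy (v j) ≤ E) →
        Tendsto (fun j => longTimeAvgSup (fun t => Real.sqrt (Torus.eGradNormSq (v j t)).toReal) /
          Real.log (ν j)⁻¹) atTop (𝓝 0)) :
    ∀ (g : UnitAddTorus (Fin 2) → EuclideanSpace ℝ (Fin 2)) (h : UnitAddTorus (Fin 2) → ℝ),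
      Torus.IsSmooth g → Torus.IsDivFree g → Torus.HasZeroMean g →
      Torus.IsSmooth h → Torus.HasZeroMean h →
      ∀ (ν : ℕ → ℝ) (v₀ : ℕ → UnitAddTorus (Fin 2) → EuclideanSpace ℝ (Fin 2))
        (v : ℕ → ℝ → UnitAddTorus (Fin 2) → EuclideanSpace ℝ (Fin 2))
        (θ₀ : ℕ → UnitAddTorus (Fin 2) → ℝ) (θ : ℕ → ℝ → UnitAddTorus (Fin 2) → ℝ),
        (∀ j, 0 < ν j) → Tendsto ν atTop (𝓝 0) →
        (∀ j, Torus.IsGlobalLerayHopf (ν j) (fun _ => g) (v₀ j) (v j)) →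
        (∀ j, MemLp (θ₀ j) 2 volume) →
        (∀ j, Torus.IsWeakScalarTransportForced (ν j) (v j) (fun _ => h) (θ₀ j) (θ j)) →
        (∃ E : ℝ, ∀ j, meanEnergy (v j) ≤ E) →
        (∃ E : ℝ, ∀ j, longTimeAvgSup (fun t => Torus.scalarL2Sq (θ j t)) ≤ E) →
        Tendsto (fun j => longTimeAvgSup (fun t => ν j * (Torus.eScalarGradNormSq (θ j t)).toReal))
          atTop (𝓝 0) :=
  (twohalfdNeg_iff_planar hG).1 (Certificate.twohalfdNeg_of_subLogStrain hS6)


/-- **Registered tools stub `stub_planarIdentification`** (conjunction of the five theorems of this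
file, registered on stmt-AnomalousDissipation-0211 with `ledger workitem stub-add`): the
identification `TwohalfdThesis ↔ ScalarAnomalySteadySourceFormal`, the complement form
`TwohalfdNeg ↔ ¬ ScalarAnomalySteadySourceFormal`, the `Tendsto` (planar no-anomaly) form of
`¬ ScalarAnomalySteadySourceFormal`, `TwohalfdNeg ↔` the planar law, and S6 `⇒` the planar law —
the glue item `ScalarLiftGlueR` (proved: `Theorems.scalarLiftGlueR_proof`) as explicit hypothesis
where used. [folklore] -/
theorem stub_planarIdentification :
    (ScalarLiftGlueR → (TwohalfdThesis ↔ ScalarAnomalySteadySourceFormal)) ∧ (ScalarLiftGlueR → (TwohalfdNeg ↔ ¬ ScalarAnomalySteadySourceFormal)) ∧ (¬ ScalarAnomalySteadySourceFormal ↔ ∀ (g : UnitAddTorus (Fin 2) → EuclideanSpace ℝ (Fin 2)) (h : UnitAddTorus (Fin 2) → ℝ), Torus.IsSmooth g → Torus.IsDivFree g → Torus.HasZeroMean g → Torus.IsSmooth h → Torus.HasZeroMean h → ∀ (ν : ℕ → ℝ) (v₀ : ℕ → UnitAddTorus (Fin 2) → EuclideanSpace ℝ (Fin 2)) (v : ℕ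 → ℝ → UnitAddTorus (Fin 2) → EuclideanSpace ℝ (Fin 2)) (θ₀ : ℕ → UnitAddTorus (Fin 2) → ℝ) (θ : ℕ → ℝ → UnitAddTorus (Fin 2) → ℝ), (∀ j, 0 < ν j) → Tendsto ν atTop (𝓝 0) → (∀ j, Torus.IsGlobalLerayHopf (ν j) (fun _ => g) (v₀ j) (v j)) → (∀ j, MemLp (θ₀ j) 2 volume) → (∀ j, Torus.IsWeakScalarTransportForced (ν j) (v j) (fun _ => h) (θ₀ j) (θ j)) → (∃ E : ℝ, ∀ j, meanEnergy (v j) ≤ E) → (∃ E : ℝ, ∀ j, longTimeAvgSup (fun t => Torus.scalarL2Sq (θ j t)) ≤ E) → Tendsto (fun j => longTimeAvgSup (fun t => ν j * (Torus.eScalarGradNormSq (θ j t)).toReal)) atTop (𝓝 0)) ∧ (ScalarLiftGlueR → (TwohalfdNeg ↔ ∀ (g : UnitAddTorus (Fin 2) → EuclideanSpace ℝ (Fin 2)) (h : UnitAddTorus (Fin 2) → ℝ), Torus.IsSmooth g → Torus.IsDivFree g → Torus.HasZeroMean g → Torus.IsSmooth h → Torus.HasZeroMean h → ∀ (ν : ℕ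 → ℝ) (v₀ : ℕ → UnitAddTorus (Fin 2) → EuclideanSpace ℝ (Fin 2)) (v : ℕ → ℝ → UnitAddTorus (Fin 2) → EuclideanSpace ℝ (Fin 2)) (θ₀ : ℕ → UnitAddTorus (Fin 2) → ℝ) (θ : ℕ → ℝ → UnitAddTorus (Fin 2) → ℝ), (∀ j, 0 < ν j) → Tendsto ν atTop (𝓝 0) → (∀ j, Torus.IsGlobalLerayHopf (ν j) (fun _ => g) (v₀ j) (v j)) → (∀ j, MemLp (θ₀ j) 2 volume) → (∀ j, Torus.IsWeakScalarTransportForced (ν j) (v j) (fun _ => h) (θ₀ j) (θ j)) → (∃ E : ℝ, ∀ j, meanEnergy (v j) ≤ E) → (∃ E : ℝ, ∀ j, longTimeAvgSup (fun t => Torus.scalarL2Sq (θ j t)) ≤ E) → Tendsto (fun j => longTimeAvgSup (fun t => ν j * (Torus.eScalarGradNormSq (θ j t)).toReal)) atTop (𝓝 0))) ∧ (ScalarLiftGlueR → (∀ g : UnitAddTorus (Fin 2) → EuclideanSpace ℝ (Fin 2), Torus.IsSmooth g → Torus.IsDivFree g → Torus.HasZeroMean g → ∀ (ν : ℕ → ℝ)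 (v₀ : ℕ → UnitAddTorus (Fin 2) → EuclideanSpace ℝ (Fin 2)) (v : ℕ → ℝ → UnitAddTorus (Fin 2) → EuclideanSpace ℝ (Fin 2)), (∀ j, 0 < ν j) → Tendsto ν atTop (𝓝 0) → (∀ j, Torus.IsGlobalLerayHopf (ν j) (fun _ => g) (v₀ j) (v j)) → (∃ E : ℝ, ∀ j, meanEnergy (v j) ≤ E) → Tendsto (fun j => longTimeAvgSup (fun t => Real.sqrt (Torus.eGradNormSq (v j t)).toReal) / Real.log (ν j)⁻¹) atTop (𝓝 0)) → ∀ (g : UnitAddTorus (Fin 2) → EuclideanSpace ℝ (Fin 2)) (h : UnitAddTorus (Fin 2) → ℝ), Torus.IsSmooth g → Torus.IsDivFree g → Torus.HasZeroMean g → Torus.IsSmooth h → Torus.HasZeroMean h → ∀ (ν : ℕ → ℝ) (v₀ : ℕ → UnitAddTorus (Fin 2) → EuclideanSpace ℝ (Fin 2)) (v : ℕ → ℝ → UnitAddTorus (Fin 2) → EuclideanSpace ℝ (Fin 2)) (θ₀ : ℕ → UnitAddTorus (Fin 2) → ℝ) (θ : ℕ → ℝ → UnitAddTorus (Fin 2)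 → ℝ), (∀ j, 0 < ν j) → Tendsto ν atTop (𝓝 0) → (∀ j, Torus.IsGlobalLerayHopf (ν j) (fun _ => g) (v₀ j) (v j)) → (∀ j, MemLp (θ₀ j) 2 volume) → (∀ j, Torus.IsWeakScalarTransportForced (ν j) (v j) (fun _ => h) (θ₀ j) (θ j)) → (∃ E : ℝ, ∀ j, meanEnergy (v j) ≤ E) → (∃ E : ℝ, ∀ j, longTimeAvgSup (fun t => Torus.scalarL2Sq (θ j t)) ≤ E) → Tendsto (fun j => longTimeAvgSup (fun t => ν j * (Torus.eScalarGradNormSq (θ j t)).toReal)) atTop (𝓝 0)) :=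
  ⟨twohalfdThesis_iff_scalarAnomalySteadySourceFormal, twohalfdNeg_iff_not_scalarAnomalySteadySourceFormal,
    not_scalarAnomalySteadySourceFormal_iff_planar, twohalfdNeg_iff_planar,
    fun hG hS6 => planar_of_subLogStrain hG hS6⟩

end Summit.AnomalousDissipation.AnomalousDissipation.Theorems.TwohalfdNeg.PlanarIdentification
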